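import Summits.BirchSwinnertonDyer.BirchSwinnertonDyer.Theorems.UniversalToricDescentUnramifiedLocalCount
import Summits.BirchSwinnertonDyer.BirchSwinnertonDyer.Theorems.ThetaPartnerAtTwoSignedTransportAtTwoResidualKummer
import HarnessLib

/-!
# The GOOD-PLACE LOCAL BLOCK of RSL_g's one-pair count: Greenberg–Vatsal's Prop. (2.4) in CORANK form for a divisible
# unramified module — `Gal(K̄_v/K_{∞,w})` acts trivially, `#H¹(K_{∞,w}, A)[p^k] = #A[p^k]` (even type), `H¹(K_{∞,w}, A) = 0` (odd type)

Route `ResidualThetaTransportAtTwo` (RTT), crux RSL_g `ResidualSignedLambdaLowerCMAtTwo` (stmt-BirchSwinnertonDyer-22608); width seat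
`prover-bsd-wall-tp2-p2x-w3` g16 (`--supports 22608 --as helper`, closes nothing). THEOREMS ONLY (no definition, no named fact, no
instance, no notation, no `sorry`). Stub plan `Cruxes/ResidualThetaCountLowerPureAtTwo/STUB-PLAN-stub_cmLambdaLower.md` rev 20 §3 item 5
(split stub S1⊕ `stub_localDualAwayTwo`): the COUNT `f·Σ_g(S₀) ≤ λ_{ℤ₂}(P_{S₀})` and FIN at the GOOD places of `S₀` are fed, block by block,
into `ColemanSideInjective.finite_and_count_prodQuot` (`hS`). A block is `D_w = H¹(Hi, A)`, `Hi = Gal(ℚ̄_ℓ/ℚ_{∞,w}) =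
localSubgroup (ker κ) ℚ_ℓ`, `A = A_ρ|_{Γ_{ℚ_ℓ}}` the cofree module of the CM partner's `ρ` (or ANY discrete `Γ_{K_v}`-module — the
abstract §1/§2 are stated, like the route `UniversalToricDescent`'s count `exists_forall_natCard_subgroupH1_localSubgroup_eq`, for an
instance-implicit action, so every local convention of the split frame instantiates them).

* §1 (any number field `K`, any `ℤ_p`-extension `κ`, any place `v`, any discrete `Γ_{K_v}`-module `A`): classes of `H¹(Hi, A)` are
  `p`-power torsion (`exists_pow_nsmul_eq_zero`); the Kummer map `H¹(Hi, A[n]) → H¹(Hi, A)` has image `H¹(Hi, A)[n]` when `A` is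
  `n`-divisible (`range_pushTorsion_eq_torsionBy`) and is injective when `Hi` acts trivially on `A` (`pushTorsion_injective_of_forall_smul_eq`).
* §2 (`v ∤ p` not split completely in `K_∞`, `A` `p`-primary, `p`-divisible, with finite layers, continuous action, inertia-trivial,
  `φ` an arithmetic Frobenius): **`Hi` acts trivially on `A` as soon as the `p`-power Frobenii fix every layer**
  (`forall_smul_eq_of_frob_pow_fix`, the route UTD's Frobenius reduction `exists_forall_localSubgroup_le_iff_pow_mem`); **EVEN type**:
  if moreover `φ^{p^R} b = q_v^{p^R} b` on `A[p^k]` for `R ≫ 0`, then `#H¹(Hi, A)[p^k] = #A[p^k]` for every `k`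
  (`natCard_torsionBy_subgroupH1_eq_of_frob_pow`, via UTD's count `#H¹(Hi, B) = #{b ∈ B : φ^{p^R} b = q_v^{p^R} b}` for `B = A[p^k]`);
  **ODD type**: if the only such `b` is `0`, then `H¹(Hi, A) = 0` (`subgroupH1_eq_zero_of_frob_pow`).
* §3 = the sequel file `…LocalBlockCountCofree.lean` (`K = ℚ`, `p = 2`, `A = A_ρ = Cofree (ρ.toLocal v) F`): EVEN trace ⟹
  `#H¹(Hi, A_ρ)[2^k] = #A_ρ[2^k] = #(𝒪/2^k)²`; ODD trace ⟹ `H¹(Hi, A_ρ) = 0` (with `CofreeFrobeniusRigidity`).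

So at a good place of EVEN trace (‖ι a_ℓ‖ < 1) the block is numerically `(F/𝒪)² ≅ (ℚ₂/ℤ₂)^{2f}` (`2f = λ_{ℤ₂}`, the `2` of RSL_g's summand
`2^{n_ℓ}·2`; the `2^{n_ℓ}` conjugate blocks are the frame's), and at ODD trace it vanishes (summand `0`). Nothing here pins values, touches
the HOLD S3, the AwayTwo pins, Θ, points or signs. BSD is not proved by any of this; RSL_g (22608) is not proved here.

References: [GreenbergVatsal2000] R. Greenberg, V. Vatsal, Invent. Math. 142 (2000), §2 Prop. (2.4) and proof (arXiv p. 22);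
[GreenbergLNM1716] §3 Lemma 3.3, §4 Lemma 4.5; [SerreGaloisCohomology1997] I §2.2, I §5.1, II §5.6; [Kato2004Asterisque] §13.8.
-/

set_option autoImplicit false
-- the Theorems namespace of this sub repeats the summit name by design (D-0017 nested layout)
set_option linter.dupNamespace false

noncomputable section

open scoped Classical

namespace Summit.BirchSwinnertonDyer.BirchSwinnertonDyer.Theorems.ThetaTransport.LocalBlockCount

open NumberField IsDedekindDomain Field
open Literature.NumberTheory.EllipticCurves Literature.NumberTheory.GaloisRepresentations
  Literature.NumberTheory.GaloisRepresentations.IsNonarchimedeanLocalField IsDedekindDomain.HeightOneSpectrum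
  Summit.BirchSwinnertonDyer.BirchSwinnertonDyer.Theorems.UniversalToricDescentLocalH1Count
  Summit.BirchSwinnertonDyer.BirchSwinnertonDyer.Theorems.UniversalToricDescentUnramifiedLocalCount
  Summit.BirchSwinnertonDyer.BirchSwinnertonDyer.Theorems.UniversalToricDescentFrobeniusReduction

/-! ## §1 Kummer bookkeeping for `H¹(Hi, A)` along `A[n] ↪ A` (`Hi = localSubgroup (ker κ) K_v`, any discrete `Γ_{K_v}`-module `A`) -/

section Kummer

variable {K : Type} [Field K] [NumberField K] {v : HeightOneSpectrum (𝓞 K)} {p : ℕ} [Fact p.Prime]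
  (κ : ZpExtension K p)
  {A : Type} [AddCommGroup A] [DistribMulAction (absoluteGaloisGroup (v.adicCompletion K)) A]
  [TopologicalSpace A] [DiscreteTopology A]

/-- **Classes of `H¹(Hi, A)` are `p`-power torsion** for a `p`-primary discrete `A` (`Hi = Gal(K̄_v/K_{∞,w})` is compact; a continuous cocycle
has finitely many values). [cite: SerreGaloisCohomology1997, I §2.2] -/
theorem exists_pow_nsmul_eq_zero (hA : ∀ a : A, ∃ k : ℕ, p ^ k • a = 0)
    (c : subgroupH1 (localSubgroup κ.kerSubgroup (v.adicCompletion K)) A) : ∃ k : ℕ, p ^ k • c = 0 := by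
  haveI : CharZero (v.adicCompletion K) := charZero_of_injective_algebraMap (algebraMap K (v.adicCompletion K)).injective
  haveI := absoluteGaloisGroup_compactSpace (v.adicCompletion K)
  have hHic : IsClosed (localSubgroup κ.kerSubgroup (v.adicCompletion K) : Set (absoluteGaloisGroup (v.adicCompletion K))) :=
    κ.isClosed_kerSubgroup.preimage (map_continuous (resGal (K := K) (v.adicCompletion K)))
  haveI : CompactSpace (localSubgroup κ.kerSubgroup (v.adicCompletion K)) := isCompact_iff_compactSpace.mp hHic.isCompact
  obtain ⟨φ, rfl⟩ := oneCocycleClass_surjective _ c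
  have hfin : (Set.range φ.1).Finite := (isCompact_range φ.1.continuous).finite_of_discrete
  choose f hf using hA
  refine ⟨hfin.toFinset.sup f, ?_⟩
  have hk : ∀ x, p ^ hfin.toFinset.sup f • φ.1 x = 0 := fun x ↦ by
    have hle : f (φ.1 x) ≤ hfin.toFinset.sup f := Finset.le_sup (hfin.mem_toFinset.mpr ⟨x, rfl⟩)
    rw [← Nat.sub_add_cancel hle, pow_add, mul_smul, hf, smul_zero]
  have hφ : ((p ^ hfin.toFinset.sup f : ℕ) : ℤ) • φ = 0 := Subtype.ext (ContinuousMap.ext fun x ↦ by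
    change ((p ^ hfin.toFinset.sup f : ℕ) : ℤ) • φ.1 x = 0
    rw [Nat.cast_smul_eq_nsmul, hk])
  rw [← Nat.cast_smul_eq_nsmul ℤ, ← oneCocycleClass_smul, hφ, oneCocycleClass_zero]

/-- **The image of the Kummer map `H¹(Hi, A[n]) → H¹(Hi, A)` is `H¹(Hi, A)[n]`** when `A` is `n`-divisible with continuous orbit maps
(`⊆`: `n` kills `A[n]`; `⊇`: the tree's `mem_range_pushH1_of_nsmul_eq_zero`, from `0 → A[n] → A →ⁿ A → 0`). [cite: SerreGaloisCohomology1997, I §2.2] -/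
theorem range_pushTorsion_eq_torsionBy (n : ℕ) (hdiv : ∀ a : A, ∃ b : A, n • b = a)
    (hcont : ∀ a : A, Continuous fun g : absoluteGaloisGroup (v.adicCompletion K) ↦ g • a) :
    (resH1Hom (ContinuousMonoidHom.id (localSubgroup κ.kerSubgroup (v.adicCompletion K)))
        (AddSubgroup.torsionBy A (n : ℤ)).subtype (fun _ _ ↦ rfl)).range =
      AddSubgroup.torsionBy (subgroupH1 (localSubgroup κ.kerSubgroup (v.adicCompletion K)) A) (n : ℤ) := by
  ext c
  constructor
  · rintro ⟨c', rfl⟩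
    rw [AddSubgroup.torsionBy.nsmul_iff, ← map_nsmul,
      Summit.BirchSwinnertonDyer.BirchSwinnertonDyer.Theorems.SignedTransportAtTwo.nsmul_discreteH1_eq_zero_of_forall
        (fun x : AddSubgroup.torsionBy A (n : ℤ) ↦ Subtype.ext (by
          rw [AddSubgroupClass.coe_nsmul, ZeroMemClass.coe_zero]; exact AddSubgroup.torsionBy.nsmul_iff.mp x.2)) c',
      map_zero]
  · intro hc
    rw [AddSubgroup.torsionBy.nsmul_iff] at hc
    have hcontH : ∀ a : A, Continuous fun g : localSubgroup κ.kerSubgroup (v.adicCompletion K) ↦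
        (g : absoluteGaloisGroup (v.adicCompletion K)) • a := fun a ↦ (hcont a).comp continuous_subtype_val
    have hrange : ∀ m : A, n • m = 0 → m ∈ Set.range (AddSubgroup.torsionBy A (n : ℤ)).subtype := fun m hm ↦
      ⟨⟨m, AddSubgroup.torsionBy.nsmul_iff.mpr hm⟩, rfl⟩
    exact Summit.BirchSwinnertonDyer.BirchSwinnertonDyer.Theorems.SignedTransportAtTwo.mem_range_pushH1_of_nsmul_eq_zero
      (AddSubgroup.torsionBy A (n : ℤ)).subtype (fun _ _ ↦ rfl) Subtype.val_injective hrange hdiv hcontH hc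

/-- **The Kummer map `H¹(Hi, A[n]) → H¹(Hi, A)` is injective when `Hi` acts trivially on `A`**: a cocycle of `A[n]` that is the coboundary of
some `m ∈ A` is `g ↦ g•m − m = 0`. [cite: SerreGaloisCohomology1997, I §5.1] -/
theorem pushTorsion_injective_of_forall_smul_eq (n : ℕ)
    (htriv : ∀ h ∈ localSubgroup κ.kerSubgroup (v.adicCompletion K), ∀ a : A, h • a = a) :
    Function.Injective (resH1Hom (ContinuousMonoidHom.id (localSubgroup κ.kerSubgroup (v.adicCompletion K)))
        (AddSubgroup.torsionBy A (n : ℤ)).subtype (fun _ _ ↦ rfl)) := by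
  rw [injective_iff_map_eq_zero]
  intro c hc
  obtain ⟨ψ, rfl⟩ := oneCocycleClass_surjective _ c
  rw [Summit.BirchSwinnertonDyer.BirchSwinnertonDyer.Theorems.SignedTransportAtTwo.resH1Hom_id_oneCocycleClass,
    oneCocycleClass_eq_zero_iff] at hc
  obtain ⟨m, hm⟩ := hc
  have hψ : ψ = 0 := by
    apply Subtype.ext
    ext g
    have h := hm g
    rw [contOneCocycles.pullback_apply] at h
    change ((ψ.1 g : AddSubgroup.torsionBy A (n : ℤ)) : A) = (g : absoluteGaloisGroup (v.adicCompletion K)) • m - m at h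
    rw [htriv _ g.2, sub_self] at h
    rw [h]
    simp
  rw [hψ, oneCocycleClass_zero]

/-- **`#H¹(Hi, A)[n] = #H¹(Hi, A[n])`** when `Hi` acts trivially on the `n`-divisible `A` (the Kummer map is a bijection onto the `n`-torsion).
[cite: SerreGaloisCohomology1997, I §2.2] -/
theorem natCard_torsionBy_subgroupH1_eq_natCard (n : ℕ) (hdiv : ∀ a : A, ∃ b : A, n • b = a)
    (hcont : ∀ a : A, Continuous fun g : absoluteGaloisGroup (v.adicCompletion K) ↦ g • a)
    (htriv : ∀ h ∈ localSubgroup κ.kerSubgroup (v.adicCompletion K), ∀ a : A, h • a = a) :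
    Nat.card (AddSubgroup.torsionBy (subgroupH1 (localSubgroup κ.kerSubgroup (v.adicCompletion K)) A) (n : ℤ)) =
      Nat.card (subgroupH1 (localSubgroup κ.kerSubgroup (v.adicCompletion K)) (AddSubgroup.torsionBy A (n : ℤ))) := by
  rw [← range_pushTorsion_eq_torsionBy κ n hdiv hcont]
  exact (Nat.card_congr (Equiv.refl _)).trans (Nat.card_range_of_injective (pushTorsion_injective_of_forall_smul_eq κ n htriv))

end Kummer

/-! ## §2 Greenberg–Vatsal Prop. (2.4) in corank form: `Hi` acts trivially; `#H¹(Hi, A)[p^k] = #A[p^k]` (even type); `H¹(Hi, A) = 0` (odd type) -/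

section GreenbergVatsal

variable {K : Type} [Field K] [NumberField K] {v : HeightOneSpectrum (𝓞 K)} {p : ℕ} [Fact p.Prime]
  (κ : ZpExtension K p)
  {A : Type} [AddCommGroup A] [DistribMulAction (absoluteGaloisGroup (v.adicCompletion K)) A]
  [TopologicalSpace A] [DiscreteTopology A]

/-- **The Frobenius fixing criterion: `Hi = Gal(K̄_v/K_{∞,w})` acts TRIVIALLY on `A`** when `v ∤ p` is not split completely in `K_∞`, inertia
acts trivially on the `p`-primary discrete `A` with finite layers, and for every `k` the `p`-power Frobenii `φ^{p^R}` (`R ≫ 0`) FIX `A[p^k]`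
pointwise: the pointwise stabiliser of `A[p^k]` is an open normal subgroup containing `I_{K_v}`, so it contains `Hi` iff it contains
`φ^{p^R}` (UTD's `exists_forall_localSubgroup_le_iff_pow_mem`). [cite: GreenbergVatsal2000, §2 Prop. (2.4) (proof, arXiv p. 22)] -/
theorem forall_smul_eq_of_frob_pow_fix (hpv : (p : 𝓞 K) ∉ v.asIdeal)
    (hns : ∃ σ : absoluteGaloisGroup (v.adicCompletion K), σ ∉ localSubgroup κ.kerSubgroup (v.adicCompletion K))
    {φ : absoluteGaloisGroup (v.adicCompletion K)} (hφ : IsFrobPow φ 1)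
    (hA : ∀ a : A, ∃ k : ℕ, p ^ k • a = 0) (hfin : ∀ k : ℕ, Finite (AddSubgroup.torsionBy A ((p ^ k : ℕ) : ℤ)))
    (hcont : ∀ a : A, Continuous fun g : absoluteGaloisGroup (v.adicCompletion K) ↦ g • a)
    (hunr : ∀ σ ∈ absInertia (v.adicCompletion K), ∀ a : A, σ • a = a)
    (hfix : ∀ k : ℕ, ∃ R₀ : ℕ, ∀ R : ℕ, R₀ ≤ R → ∀ a : A, p ^ k • a = 0 → φ ^ p ^ R • a = a) :
    ∀ h ∈ localSubgroup κ.kerSubgroup (v.adicCompletion K), ∀ a : A, h • a = a := by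
  intro h hh a
  obtain ⟨k, hk⟩ := hA a
  -- the pointwise stabiliser of the layer `A[p^k]`
  let T : AddSubgroup A := AddSubgroup.torsionBy A ((p ^ k : ℕ) : ℤ)
  haveI : Finite T := hfin k
  have hTsmul : ∀ (g : absoluteGaloisGroup (v.adicCompletion K)) (t : A), t ∈ T → g • t ∈ T := fun g _ ht ↦
    smul_mem_torsionBy g ht
  let N₀ : Subgroup (absoluteGaloisGroup (v.adicCompletion K)) := ⨅ t : T, MulAction.stabilizer _ (t : A)
  have hN₀ : ∀ g, g ∈ N₀ ↔ ∀ t : T, g • (t : A) = t := fun g ↦ by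
    simp only [N₀, Subgroup.mem_iInf, MulAction.mem_stabilizer_iff]
  haveI : N₀.Normal := ⟨fun g hg x ↦ (hN₀ _).mpr fun t ↦ by
    have h1 : g • (x⁻¹ • (t : A)) = x⁻¹ • (t : A) := (hN₀ g).mp hg ⟨_, hTsmul _ _ t.2⟩
    rw [mul_smul, mul_smul, h1, smul_inv_smul]⟩
  have hopen : IsOpen (N₀ : Set (absoluteGaloisGroup (v.adicCompletion K))) := by
    have hset : (N₀ : Set (absoluteGaloisGroup (v.adicCompletion K))) = ⋂ t : T, (fun g ↦ g • (t : A)) ⁻¹' {(t : A)} := by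
      ext g
      simp only [SetLike.mem_coe, hN₀, Set.mem_iInter, Set.mem_preimage, Set.mem_singleton_iff]
    rw [hset]
    exact isOpen_iInter_of_finite fun t ↦ (isOpen_discrete _).preimage (hcont _)
  have hI : absInertia (v.adicCompletion K) ≤ N₀ := fun σ hσ ↦ (hN₀ σ).mpr fun t ↦ hunr σ hσ _
  obtain ⟨R₁, hR₁⟩ := exists_forall_localSubgroup_le_iff_pow_mem κ hpv hns hφ N₀ hopen
  obtain ⟨R₂, hR₂⟩ := hfix k
  have hmem : φ ^ p ^ max R₁ R₂ ∈ N₀ := (hN₀ _).mpr fun t ↦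
    hR₂ _ (le_max_right _ _) _ (AddSubgroup.torsionBy.nsmul_iff.mp t.2)
  have hle : localSubgroup κ.kerSubgroup (v.adicCompletion K) ≤ N₀ := (hR₁ _ (le_max_left _ _) N₀ hI le_rfl).mpr hmem
  exact (hN₀ h).mp (hle hh) ⟨a, AddSubgroup.torsionBy.nsmul_iff.mpr hk⟩

omit [Fact p.Prime] [TopologicalSpace A] [DiscreteTopology A] in
/-- From `p`-divisibility to `p^k`-divisibility. [folklore] -/
theorem exists_pow_nsmul_eq_of_forall_exists (hdiv : ∀ a : A, ∃ b : A, p • b = a) (k : ℕ) (a : A) : ∃ b : A, p ^ k • b = a := by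
  induction k generalizing a with
  | zero => exact ⟨a, by rw [pow_zero, one_smul]⟩
  | succ k ih =>
    obtain ⟨b, rfl⟩ := hdiv a
    obtain ⟨c, rfl⟩ := ih b
    exact ⟨c, by rw [pow_succ, mul_smul, smul_comm]⟩

/-- **Greenberg–Vatsal Prop. (2.4), EVEN type, corank form: `#H¹(K_{∞,w}, A)[p^k] = #A[p^k]` for every `k`.** Hypotheses: `v ∤ p` not split
completely in the `ℤ_p`-extension, `A` a discrete `p`-primary `p`-divisible `Γ_{K_v}`-module with finite layers, continuous orbit maps and
trivial inertia action, `φ` an arithmetic Frobenius whose `p`-power iterates eventually FIX each layer (`hfix`) and satisfy the twisted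
fixed-point equation `φ^{p^R} b = q_v^{p^R} b` on each layer (`htwist`). Proof: `Hi` acts trivially (`forall_smul_eq_of_frob_pow_fix`), so the
Kummer map is a bijection `H¹(Hi, A[p^k]) ≅ H¹(Hi, A)[p^k]`, and UTD's count `#H¹(Hi, B) = #{b ∈ B : φ^{p^R} b = q_v^{p^R} b}` for
`B = A[p^k]` counts everything. [cite: GreenbergVatsal2000, §2 Prop. (2.4) and proof (arXiv p. 22)] [cite: GreenbergLNM1716, §3 Lemma 3.3] -/
theorem natCard_torsionBy_subgroupH1_eq_of_frob_pow (hpv : (p : 𝓞 K) ∉ v.asIdeal)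
    (hns : ∃ σ : absoluteGaloisGroup (v.adicCompletion K), σ ∉ localSubgroup κ.kerSubgroup (v.adicCompletion K))
    {φ : absoluteGaloisGroup (v.adicCompletion K)} (hφ : IsFrobPow φ 1)
    (hA : ∀ a : A, ∃ k : ℕ, p ^ k • a = 0) (hdiv : ∀ a : A, ∃ b : A, p • b = a)
    (hfin : ∀ k : ℕ, Finite (AddSubgroup.torsionBy A ((p ^ k : ℕ) : ℤ)))
    (hcont : ∀ a : A, Continuous fun g : absoluteGaloisGroup (v.adicCompletion K) ↦ g • a)
    (hunr : ∀ σ ∈ absInertia (v.adicCompletion K), ∀ a : A, σ • a = a)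
    (hfix : ∀ k : ℕ, ∃ R₀ : ℕ, ∀ R : ℕ, R₀ ≤ R → ∀ a : A, p ^ k • a = 0 → φ ^ p ^ R • a = a)
    (htwist : ∀ k : ℕ, ∃ R₀ : ℕ, ∀ R : ℕ, R₀ ≤ R → ∀ a : A, p ^ k • a = 0 →
      φ ^ p ^ R • a = (residueFieldCard (v.adicCompletion K) ^ p ^ R) • a)
    (k : ℕ) :
    Nat.card (AddSubgroup.torsionBy (subgroupH1 (localSubgroup κ.kerSubgroup (v.adicCompletion K)) A) ((p ^ k : ℕ) : ℤ)) =
      Nat.card (AddSubgroup.torsionBy A ((p ^ k : ℕ) : ℤ)) := by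
  have htriv := forall_smul_eq_of_frob_pow_fix κ hpv hns hφ hA hfin hcont hunr hfix
  rw [natCard_torsionBy_subgroupH1_eq_natCard κ (p ^ k) (exists_pow_nsmul_eq_of_forall_exists hdiv k) hcont htriv]
  -- UTD's count for the finite layer `B = A[p^k]`
  haveI : Finite (AddSubgroup.torsionBy A ((p ^ k : ℕ) : ℤ)) := hfin k
  have hB : ∃ k' : ℕ, ∀ b : AddSubgroup.torsionBy A ((p ^ k : ℕ) : ℤ), p ^ k' • b = 0 :=
    ⟨k, fun b ↦ Subtype.ext (by rw [AddSubgroupClass.coe_nsmul, ZeroMemClass.coe_zero]; exact AddSubgroup.torsionBy.nsmul_iff.mp b.2)⟩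
  have hcontB : ∀ b : AddSubgroup.torsionBy A ((p ^ k : ℕ) : ℤ),
      Continuous fun g : absoluteGaloisGroup (v.adicCompletion K) ↦ g • b := fun b ↦
    continuous_induced_rng.mpr (by simpa only [Function.comp_def, AddSubgroup.torsionBy.coe_smul] using hcont (b : A))
  have hunrB : ∀ σ ∈ absInertia (v.adicCompletion K), ∀ b : AddSubgroup.torsionBy A ((p ^ k : ℕ) : ℤ), σ • b = b :=
    fun σ hσ b ↦ Subtype.ext (by rw [AddSubgroup.torsionBy.coe_smul]; exact hunr σ hσ _)
  obtain ⟨R₁, hR₁⟩ := exists_forall_natCard_subgroupH1_localSubgroup_eq κ hpv hns hB hcontB hunrB hφ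
  obtain ⟨R₂, hR₂⟩ := htwist k
  rw [hR₁ (max R₁ R₂) (le_max_left _ _)]
  refine Nat.card_congr (Equiv.subtypeUnivEquiv fun b ↦ Subtype.ext ?_)
  rw [AddSubgroup.torsionBy.coe_smul, AddSubgroupClass.coe_nsmul]
  exact hR₂ _ (le_max_right _ _) _ (AddSubgroup.torsionBy.nsmul_iff.mp b.2)

/-- **Greenberg–Vatsal Prop. (2.4), ODD type: `H¹(K_{∞,w}, A) = 0`.** Same setting (no `hfix`), but now the twisted fixed-point equation
`φ^{p^R} b = q_v^{p^R} b` has ONLY the solution `b = 0` on each layer (`hnone`). Every class is `p^k`-torsion for some `k`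
(`exists_pow_nsmul_eq_zero`), hence in the image of `H¹(Hi, A[p^k])`, a group with ONE element by UTD's count.
[cite: GreenbergVatsal2000, §2 Prop. (2.4) and proof (arXiv p. 22)] [cite: GreenbergLNM1716, §3 Lemma 3.3] -/
theorem subgroupH1_eq_zero_of_frob_pow (hpv : (p : 𝓞 K) ∉ v.asIdeal)
    (hns : ∃ σ : absoluteGaloisGroup (v.adicCompletion K), σ ∉ localSubgroup κ.kerSubgroup (v.adicCompletion K))
    {φ : absoluteGaloisGroup (v.adicCompletion K)} (hφ : IsFrobPow φ 1)
    (hA : ∀ a : A, ∃ k : ℕ, p ^ k • a = 0) (hdiv : ∀ a : A, ∃ b : A, p • b = a)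
    (hfin : ∀ k : ℕ, Finite (AddSubgroup.torsionBy A ((p ^ k : ℕ) : ℤ)))
    (hcont : ∀ a : A, Continuous fun g : absoluteGaloisGroup (v.adicCompletion K) ↦ g • a)
    (hunr : ∀ σ ∈ absInertia (v.adicCompletion K), ∀ a : A, σ • a = a)
    (hnone : ∀ k : ℕ, ∃ R₀ : ℕ, ∀ R : ℕ, R₀ ≤ R → ∀ a : A, p ^ k • a = 0 →
      φ ^ p ^ R • a = (residueFieldCard (v.adicCompletion K) ^ p ^ R) • a → a = 0)
    (c : subgroupH1 (localSubgroup κ.kerSubgroup (v.adicCompletion K)) A) : c = 0 := by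
  obtain ⟨k, hk⟩ := exists_pow_nsmul_eq_zero κ hA c
  have hc : c ∈ AddSubgroup.torsionBy (subgroupH1 (localSubgroup κ.kerSubgroup (v.adicCompletion K)) A) ((p ^ k : ℕ) : ℤ) :=
    AddSubgroup.torsionBy.nsmul_iff.mpr hk
  rw [← range_pushTorsion_eq_torsionBy κ (p ^ k) (exists_pow_nsmul_eq_of_forall_exists hdiv k) hcont] at hc
  obtain ⟨c', rfl⟩ := hc
  -- `H¹(Hi, A[p^k])` has exactly one element
  haveI : Finite (AddSubgroup.torsionBy A ((p ^ k : ℕ) : ℤ)) := hfin k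
  have hB : ∃ k' : ℕ, ∀ b : AddSubgroup.torsionBy A ((p ^ k : ℕ) : ℤ), p ^ k' • b = 0 :=
    ⟨k, fun b ↦ Subtype.ext (by rw [AddSubgroupClass.coe_nsmul, ZeroMemClass.coe_zero]; exact AddSubgroup.torsionBy.nsmul_iff.mp b.2)⟩
  have hcontB : ∀ b : AddSubgroup.torsionBy A ((p ^ k : ℕ) : ℤ),
      Continuous fun g : absoluteGaloisGroup (v.adicCompletion K) ↦ g • b := fun b ↦
    continuous_induced_rng.mpr (by simpa only [Function.comp_def, AddSubgroup.torsionBy.coe_smul] using hcont (b : A))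
  have hunrB : ∀ σ ∈ absInertia (v.adicCompletion K), ∀ b : AddSubgroup.torsionBy A ((p ^ k : ℕ) : ℤ), σ • b = b :=
    fun σ hσ b ↦ Subtype.ext (by rw [AddSubgroup.torsionBy.coe_smul]; exact hunr σ hσ _)
  obtain ⟨R₁, hR₁⟩ := exists_forall_natCard_subgroupH1_localSubgroup_eq κ hpv hns hB hcontB hunrB hφ
  obtain ⟨R₂, hR₂⟩ := hnone k
  have hone : Nat.card (subgroupH1 (localSubgroup κ.kerSubgroup (v.adicCompletion K)) (AddSubgroup.torsionBy A ((p ^ k : ℕ) : ℤ))) = 1 := by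
    rw [hR₁ (max R₁ R₂) (le_max_left _ _), Nat.card_eq_one_iff_unique]
    refine ⟨⟨fun x y ↦ Subtype.ext ?_⟩, ⟨⟨0, by rw [smul_zero, smul_zero]⟩⟩⟩
    have hx : (x : AddSubgroup.torsionBy A ((p ^ k : ℕ) : ℤ)) = 0 := Subtype.ext (hR₂ _ (le_max_right _ _) _
      (AddSubgroup.torsionBy.nsmul_iff.mp x.1.2) (by
        have h := congrArg (fun b : AddSubgroup.torsionBy A ((p ^ k : ℕ) : ℤ) ↦ (b : A)) x.2
        simpa only [AddSubgroup.torsionBy.coe_smul, AddSubgroupClass.coe_nsmul] using h))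
    have hy : (y : AddSubgroup.torsionBy A ((p ^ k : ℕ) : ℤ)) = 0 := Subtype.ext (hR₂ _ (le_max_right _ _) _
      (AddSubgroup.torsionBy.nsmul_iff.mp y.1.2) (by
        have h := congrArg (fun b : AddSubgroup.torsionBy A ((p ^ k : ℕ) : ℤ) ↦ (b : A)) y.2
        simpa only [AddSubgroup.torsionBy.coe_smul, AddSubgroupClass.coe_nsmul] using h))
    rw [hx, hy]
  haveI : Finite (subgroupH1 (localSubgroup κ.kerSubgroup (v.adicCompletion K)) (AddSubgroup.torsionBy A ((p ^ k : ℕ) : ℤ))) :=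
    Nat.finite_of_card_ne_zero (by rw [hone]; exact one_ne_zero)
  haveI : Subsingleton (subgroupH1 (localSubgroup κ.kerSubgroup (v.adicCompletion K)) (AddSubgroup.torsionBy A ((p ^ k : ℕ) : ℤ))) :=
    Finite.card_le_one_iff_subsingleton.mp hone.le
  rw [Subsingleton.elim c' 0, map_zero]

end GreenbergVatsal

end Summit.BirchSwinnertonDyer.BirchSwinnertonDyer.Theorems.ThetaTransport.LocalBlockCount

end
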